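import Mathlib
import Literature.Computability.Complexity.SelfCorrection
import Literature.Computability.Complexity.LowDegreeZeroTest
import HarnessLib

/-!
# An oracle proof system for algebraic constraint satisfaction over `Hᵐ` (BFL / BFLS verifier): definitions and completeness

Literature / complexity toolkit, sixth brick of the algebraic engine of probabilistically
checkable proofs for exponential-time computations, assembling the previous five
(`LowDegreeTest`, `SumcheckField`, `LowDegreeExtension`, `LowDegreeZeroTest`, `SelfCorrection`)
into the verifier of Babai–Fortnow–Lund 1991, §4–§7 / Babai–Fortnow–Levin–Szegedy 1991, §5
(Arora–Barak 2009, §8.6 "The power of the prover in `MIP = NEXP`", §11.5.2) for an abstract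
**algebraic CSP**: the unknown is a table `Y : Hᵐ → F`, a constraint FAMILY `φ` reads `Y` at
`r_φ` ADDRESSES of the constraint index `z ∈ Hᴷ` (each address coordinate is a coordinate of `z`
or a constant of `H`) and requires a fixed polynomial `P_φ(z, Y(addr₁ z), …, Y(addr_r z))` to
vanish for every `z ∈ Hᴷ`. (Booleanity `Y(1 - Y) = 0`, bit decompositions, gate equations and
clause semantics of a succinctly described CNF are such families.)

The **proof** is an oracle `Y : Fᵐ → F` (allegedly the low-degree extension of a satisfying
table) together with a table `S` of sumcheck messages; the **verifier** with random tape
`(ρ, λ, r, tests, dirs)` (i) runs `T` Rubinfeld–Sudan tests on `Y`, (ii) checks by the sumcheck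
protocol, against the messages `S(ρ, λ, ·)`, the claim
`∑_{c ∈ Hᴷ} Ψ_λ(c) · EQ_H(c, ρ) = 0`, where `Ψ_λ = ∑_φ λ_φ P_φ(·, Y ∘ addr)` is the random
combination of the constraint values and `EQ_H(c, ρ) = ∏ₜ eqPoly H cₜ ρₜ` the kernel of the
low-degree extension (so the sum is the extension `Ψ̂_λ(ρ)` of `Ψ_λ|_{Hᴷ}`, `psum_Φ`), reading
the `Y`-values needed at the final random point `r` through the SELF-CORRECTOR with fresh random
directions `dirs`.

This file: the objects (`Family`, `CSP`, `Proof`, `Tape`; the predicates `Family.WF`, `CSP.WF`,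
`CSP.Satisfies`, `CSP.Satisfiable`, `passRS`, `passSum`, `Accept`, `GoodSC` are `Prop`-valued
structures), the algebra connecting the verifier's final check with the sumcheck summand of the
ANALYSIS (`Φ`, `axisPoly_Φ`, `psum_Φ`, `finalVal_eq_Φ`, `accepts_of_goodSC`), and **completeness**
(`completeness`: a satisfiable, well-formed CSP has a proof accepted on EVERY tape — the low-degree
extension of the satisfying table and the honest sumcheck messages). Soundness (the counting) is in
`AlgebraicPCPSoundness.lean`; the instance (the arithmetized Cook–Levin tableau of a machine) in
`TableauCSP.lean`. Nothing here is in Mathlib or the tree (searched `sumcheck`, `PCP`, `MIP`,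
`arithmetiz`: the tree's `SumcheckCNF` / `SumcheckIPReferee` / `PropFormArithmetization` are the
`#SAT`/`TQBF` protocols over `ℤ`, with the formula as explicit input, not an oracle proof system).

## References

* L. Babai, L. Fortnow, C. Lund, *Non-deterministic exponential time has two-prover interactive
  protocols*, Comput. Complexity 1 (1991), §4–§7 [BabaiFortnowLund1991].
* L. Babai, L. Fortnow, L. Levin, M. Szegedy, *Checking computations in polylogarithmic time*,
  STOC 1991, §5 [BFLS1991].
* S. Arora, B. Barak, *Computational Complexity: A Modern Approach*, CUP 2009, §8.6, §11.5.2
  [AroraBarakCC2009].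
-/

noncomputable section

open Finset Polynomial

namespace Literature.Computability.Complexity

namespace AlgebraicPCP

open LowDegreeExtension LowDegreeTest SumcheckF

variable {F : Type*}

/-! ### The cube sum of `SumcheckField.lean` as a sum over `Hᴷ` -/

/-- `cubeSum H K G = ∑_{c : Fin K → H} G(c₀, …, c_{K-1})`. [folklore] -/
theorem cubeSum_eq_sum {M : Type*} [AddCommMonoid M] (H : Finset F) :
    ∀ (K : ℕ) (G : List F → M), cubeSum H K G = ∑ c : Fin K → H, G (List.ofFn fun t => (c t : F))
  | 0, G => by simp
  | K + 1, G => by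
    rw [cubeSum_succ]
    have ih : ∀ a : F, cubeSum H K (fun l => G (a :: l)) =
        ∑ c : Fin K → H, G (a :: List.ofFn fun t => (c t : F)) := fun a => cubeSum_eq_sum H K _
    simp only [ih]
    rw [← sum_coe_sort H, ← Fintype.sum_prod_type']
    refine Fintype.sum_equiv (Fin.consEquiv fun _ => (H : Type _)) _ _ fun p => ?_
    congr 1
    rw [List.ofFn_succ]
    simp [Fin.consEquiv]

variable [Field F]

/-! ### The kernel `eqPoly` of the low-degree extension -/

section EqPoly

variable [DecidableEq F] (H : Finset F)

/-- The symmetric kernel `EQ_H(a, b) = ∑_{e ∈ H} L_e(a) L_e(b)` of the low-degree extension: a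
polynomial of degree `≤ #H - 1` in each argument which for `a ∈ H` is the Lagrange basis value
`L_a(b)`. [cite: BFLS1991, §4] -/
def eqPoly (a b : F) : F := ∑ e ∈ H, (Lagrange.basis H id e).eval a * (Lagrange.basis H id e).eval b

/-- On a node the kernel is the Lagrange basis polynomial of that node. [cite: BFLS1991, §4] -/
theorem eqPoly_of_mem {a : F} (ha : a ∈ H) (b : F) : eqPoly H a b = (Lagrange.basis H id a).eval b := by
  unfold eqPoly
  rw [sum_eq_single a]
  · rw [eval_basis_mem ha ha, if_pos rfl, one_mul]
  · intro e he hne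
    rw [eval_basis_mem he ha, if_neg hne, zero_mul]
  · intro h
    exact absurd ha h

/-- The kernel as a one-variable polynomial in its first argument. [folklore] -/
def eqPolyX (b : F) : F[X] := ∑ e ∈ H, Polynomial.C ((Lagrange.basis H id e).eval b) * Lagrange.basis H id e

/-- Evaluating `eqPolyX`. [folklore] -/
theorem eval_eqPolyX (a b : F) : (eqPolyX H b).eval a = eqPoly H a b := by
  unfold eqPolyX eqPoly
  rw [eval_finsetSum]
  refine sum_congr rfl fun e _ => ?_
  rw [eval_mul, eval_C, mul_comm]

/-- Degree of the kernel in its first argument. [folklore] -/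
theorem natDegree_eqPolyX_le (b : F) : (eqPolyX H b).natDegree ≤ H.card - 1 :=
  natDegree_sum_le_of_forall_le _ _ fun e he => (natDegree_C_mul_le _ _).trans
    (by rw [Lagrange.natDegree_basis (v := id) (fun _ _ _ _ h => h) he])

/-- `z ↦ ∏ₜ EQ_H(zₜ, ρₜ)` is coordinatewise of degree `≤ #H - 1`. [cite: BFLS1991, §4] -/
theorem coordPoly_prod_eqPoly {k : ℕ} (ρ : Fin k → F) :
    CoordPoly (fun z : Fin k → F => ∏ t, eqPoly H (z t) (ρ t)) (H.card - 1) := by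
  have h := CoordPoly.prod_proj (H.card - 1) (P := fun t => eqPolyX H (ρ t)) fun t => natDegree_eqPolyX_le H (ρ t)
  simpa only [eval_eqPolyX] using h

/-- **The low-degree extension through the kernel**:
`Ψ̂(ρ) = ∑_{c ∈ Hᵏ} Ψ(c) ∏ₜ EQ_H(cₜ, ρₜ)`. [cite: BFLS1991, §4] -/
theorem lde_eq_sum_eqPoly {k : ℕ} (Ψ : (Fin k → F) → F) (ρ : Fin k → F) :
    lde H Ψ ρ = ∑ c : Fin k → H, Ψ (fun t => (c t : F)) * ∏ t, eqPoly H (c t : F) (ρ t) := by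
  unfold lde ldeTerm
  refine sum_congr rfl fun c _ => ?_
  congr 1
  exact prod_congr rfl fun t _ => (eqPoly_of_mem H (c t).2 _).symm

end EqPoly

/-! ### Addresses, read compositions, coordinatewise degree of compositions -/

section Read

variable {K m : ℕ}

/-- **Reading an address**: coordinate `u` of the address of the constraint index `z` is either
the coordinate `z i` (`a u = inl i`) or the constant `c` (`a u = inr c`). [cite: BabaiFortnowLund1991, §4] -/
def readAddr (a : Fin m → Fin K ⊕ F) (z : Fin K → F) : Fin m → F := fun u => Sum.elim z id (a u)

/-- Moving one coordinate of the index moves the address along a line. [folklore] -/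
theorem readAddr_update [DecidableEq F] (a : Fin m → Fin K ⊕ F) (z : Fin K → F) (t : Fin K) (s : F) :
    readAddr a (Function.update z t s) =
      readAddr a (Function.update z t 0) + s • fun u => if a u = Sum.inl t then (1 : F) else 0 := by
  funext u
  simp only [readAddr, Pi.add_apply, Pi.smul_apply, smul_eq_mul]
  rcases h : a u with i | c
  · simp only [Sum.elim_inl, Sum.inl.injEq]
    by_cases hit : i = t
    · subst hit
      simp
    · simp [hit]
  · simp

/-- **A function that is a polynomial on every line, read at an address, is coordinatewise of the
same degree** (the address moves along a line when one index coordinate moves).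
[cite: AroraBarakCC2009, §8.6.2] -/
theorem coordPoly_read [DecidableEq F] {g : (Fin m → F) → F} {d : ℕ} (hg : LinePoly g d) (a : Fin m → Fin K ⊕ F) :
    CoordPoly (fun z => g (readAddr a z)) d := by
  refine ⟨fun t z => ?_⟩
  obtain ⟨P, hP, hPe⟩ := hg.poly (readAddr a (Function.update z t 0)) fun u => if a u = Sum.inl t then 1 else 0
  refine ⟨P, hP, fun s => ?_⟩
  show g (readAddr a (Function.update z t s)) = _
  rw [readAddr_update, hPe]

end Read

section Compose

variable {k : ℕ}

/-- Powers of a coordinatewise low-degree function. [folklore] -/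
theorem coordPoly_pow {G : (Fin k → F) → F} {d : ℕ} (hG : CoordPoly G d) :
    ∀ n : ℕ, CoordPoly (fun z => G z ^ n) (n * d)
  | 0 => by simpa using CoordPoly.const (k := k) 0 (1 : F)
  | n + 1 => by
    have h := (coordPoly_pow hG n).mul hG
    simpa only [pow_succ, Nat.succ_mul] using h

/-- Finite products of coordinatewise low-degree functions (degrees add). [folklore] -/
theorem coordPoly_finset_prod {ι : Type*} (s : Finset ι) {Gi : ι → (Fin k → F) → F} {di : ι → ℕ}
    (h : ∀ i ∈ s, CoordPoly (Gi i) (di i)) : CoordPoly (fun z => ∏ i ∈ s, Gi i z) (∑ i ∈ s, di i) := by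
  classical
  induction s using Finset.induction_on with
  | empty => simpa using CoordPoly.const (k := k) 0 (1 : F)
  | insert a s ha ih =>
    have h' := (h a (mem_insert_self a s)).mul (ih fun i hi => h i (mem_insert_of_mem hi))
    simpa only [prod_insert ha, sum_insert ha] using h'

/-- **Substituting coordinatewise low-degree functions into a polynomial**: if every `G_v` is
coordinatewise of degree `≤ d`, then `z ↦ P(G_v(z))_v` is coordinatewise of degree
`≤ deg P · d`. [folklore] -/
theorem coordPoly_eval_mvPolynomial {ι : Type*} [DecidableEq ι] (P : MvPolynomial ι F)
    {Gv : ι → (Fin k → F) → F} {d : ℕ} (hG : ∀ v, CoordPoly (Gv v) d) :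
    CoordPoly (fun z => MvPolynomial.eval (fun v => Gv v z) P) (P.totalDegree * d) := by
  have hfun : (fun z => MvPolynomial.eval (fun v => Gv v z) P) =
      fun z => ∑ s ∈ P.support, P.coeff s * ∏ v ∈ s.support, Gv v z ^ s v :=
    funext fun z => MvPolynomial.eval_eq _ _
  rw [hfun]
  refine CoordPoly.finset_sum _ fun s hs => ?_
  have h1 : CoordPoly (fun z => ∏ v ∈ s.support, Gv v z ^ s v) (∑ v ∈ s.support, s v * d) :=
    coordPoly_finset_prod _ fun v _ => coordPoly_pow (hG v) (s v)
  have h2 := (CoordPoly.const (k := k) 0 (P.coeff s)).mul h1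
  simp only [zero_add] at h2
  refine h2.mono ?_
  rw [← sum_mul]
  exact Nat.mul_le_mul_right _ (MvPolynomial.le_totalDegree hs)

end Compose

/-! ### Algebraic constraint satisfaction problems over `Hᵐ` -/

/-- **A constraint family**: `arity` oracle reads at the addresses `addr j` of the constraint index
and a polynomial `poly` in the `K` index coordinates (`inl`) and the `arity` read values (`inr`)
that must vanish. [cite: BabaiFortnowLund1991, §4 (oracle-3SAT normal form)] -/
structure Family (F : Type*) [Field F] (K m : ℕ) where
  /-- number of oracle reads -/
  arity : ℕ
  /-- the addresses read, as coordinate maps -/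
  addr : Fin arity → Fin m → Fin K ⊕ F
  /-- the constraint polynomial in index coordinates and read values -/
  poly : MvPolynomial (Fin K ⊕ Fin arity) F

namespace Family

variable {K m : ℕ}

/-- The value of the constraint polynomial on an index `z` and read values `y`. [folklore] -/
def value (φ : Family F K m) (z : Fin K → F) (y : Fin φ.arity → F) : F :=
  MvPolynomial.eval (Sum.elim z y) φ.poly

/-- The value of the constraint on the oracle `Y` at the index `z`. [cite: BabaiFortnowLund1991, §4] -/
def eval (φ : Family F K m) (Y : (Fin m → F) → F) (z : Fin K → F) : F :=
  φ.value z fun j => Y (readAddr (φ.addr j) z)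

/-- Well-formedness: the constants in the addresses are nodes of `H`. [folklore] -/
structure WF (φ : Family F K m) (H : Finset F) : Prop where
  /-- every constant coordinate of every address is a node -/
  mem : ∀ j u c, φ.addr j u = Sum.inr c → c ∈ H

/-- The addresses of an `H`-index are `H`-points (for a well-formed family). [folklore] -/
theorem readAddr_mem {φ : Family F K m} {H : Finset F} (hφ : φ.WF H) (j : Fin φ.arity) {z : Fin K → F}
    (hz : ∀ t, z t ∈ H) (u : Fin m) : readAddr (φ.addr j) z u ∈ H := by
  unfold readAddr
  rcases h : φ.addr j u with i | c
  · exact hz i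
  · exact hφ.mem j u c h

/-- Two oracles agreeing at the addresses give the same constraint value. [folklore] -/
theorem eval_congr (φ : Family F K m) {Y Y' : (Fin m → F) → F} {z : Fin K → F}
    (h : ∀ j, Y (readAddr (φ.addr j) z) = Y' (readAddr (φ.addr j) z)) : φ.eval Y z = φ.eval Y' z := by
  unfold eval
  congr 1
  funext j
  exact h j

end Family

/-- **An algebraic CSP**: finitely many constraint families. [cite: BabaiFortnowLund1991, §4] -/
structure CSP (F : Type*) [Field F] (K m : ℕ) where
  /-- number of families -/
  N : ℕ
  /-- the families -/
  fam : Fin N → Family F K m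

namespace CSP

variable {K m : ℕ}

/-- The oracle `Y` satisfies the CSP on the node set `H`: every family vanishes at every index of
`Hᴷ`. [cite: BabaiFortnowLund1991, §4] -/
structure Satisfies (C : CSP F K m) (H : Finset F) (Y : (Fin m → F) → F) : Prop where
  /-- every family vanishes at every `H`-index -/
  eval_eq_zero : ∀ (φ : Fin C.N) (z : Fin K → F), (∀ t, z t ∈ H) → (C.fam φ).eval Y z = 0

/-- Satisfiability. [cite: BabaiFortnowLund1991, §4] -/
structure Satisfiable (C : CSP F K m) (H : Finset F) : Prop where
  /-- some oracle satisfies the CSP -/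
  exists_satisfies : ∃ Y : (Fin m → F) → F, C.Satisfies H Y

/-- Well-formedness of all families. [folklore] -/
structure WF (C : CSP F K m) (H : Finset F) : Prop where
  /-- every family is well formed -/
  wf : ∀ φ, (C.fam φ).WF H

/-- The oracle queries of the final check: a family and one of its reads. [folklore] -/
abbrev Qry (C : CSP F K m) : Type := Σ φ : Fin C.N, Fin (C.fam φ).arity

/-- The largest total degree of a constraint polynomial. [folklore] -/
def maxDeg (C : CSP F K m) : ℕ := univ.sup fun φ => (C.fam φ).poly.totalDegree

/-- Each constraint polynomial has degree `≤ maxDeg`. [folklore] -/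
theorem totalDegree_le_maxDeg (C : CSP F K m) (φ : Fin C.N) : (C.fam φ).poly.totalDegree ≤ C.maxDeg :=
  Finset.le_sup (f := fun φ => (C.fam φ).poly.totalDegree) (mem_univ φ)

end CSP

/-! ### Proofs, tapes and the verifier -/

/-- The verifier's parameters: the degree `d` of the low-degree test and of the self-corrector, the
degree bound `D` of the sumcheck messages, and the number `T` of low-degree tests. [folklore] -/
structure Params where
  /-- degree of the Rubinfeld–Sudan test / self-corrector -/
  d : ℕ
  /-- degree bound checked on the sumcheck messages -/
  D : ℕ
  /-- number of low-degree tests -/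
  T : ℕ

/-- **A proof**: the oracle `Y : Fᵐ → F` and the table `S` of sumcheck messages, indexed by the
verifier's `ρ`, the seed `λ` of the random combination and the challenge prefix (the parameter
`N`, the number of families, is not used by the data and only tags the type).
[cite: BabaiFortnowLund1991, §4–§5] -/
structure Proof (F : Type*) [Field F] (K m N : ℕ) where
  /-- the (alleged) low-degree extension of the table -/
  Y : (Fin m → F) → F
  /-- sumcheck messages, indexed by `ρ`, the seed `λ` and the challenge prefix -/
  S : (Fin K → F) → F → List F → F[X]

/-- **A random tape**: the point `ρ` of the zero test, the seed `λ` of the random combination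
(family `φ` gets the coefficient `λ^φ` — ONE random field element, so that the message table is
indexed by `O(K)` field elements), the sumcheck challenges `r`, the `T` low-degree tests and one
self-correction direction per oracle query. [cite: BabaiFortnowLund1991, §5] [cite: AroraBarakCC2009, §11.5.2] -/
structure Tape (F : Type*) [Field F] {K m : ℕ} (C : CSP F K m) (T : ℕ) where
  /-- point of the subcube zero test -/
  ρ : Fin K → F
  /-- seed of the random combination of the families -/
  seed : F
  /-- sumcheck challenges -/
  r : Fin K → F
  /-- the pairs `(x, t)` of the low-degree tests -/
  tests : Fin T → (Fin m → F) × (Fin m → F)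
  /-- self-correction directions, one per query -/
  dirs : C.Qry → Fin m → F

/-- The coefficients of the random combination: the powers `λ^φ` of the seed. [cite: AroraBarakCC2009, §11.5.2] -/
def Tape.lam {F : Type*} [Field F] {K m : ℕ} {C : CSP F K m} {T : ℕ} (τ : Tape F C T) : Fin C.N → F :=
  fun φ => τ.seed ^ (φ : ℕ)

section Verifier

variable [DecidableEq F] {K m : ℕ} (H : Finset F) (prm : Params) (C : CSP F K m)

/-- The self-corrected oracle value of the query `q` at the final sumcheck point.
[cite: AroraBarakCC2009, §8.6.2] -/
def scVal (π : Proof F K m C.N) (τ : Tape F C prm.T) (q : C.Qry) : F :=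
  selfCorrect prm.d π.Y (readAddr ((C.fam q.1).addr q.2) τ.r) (τ.dirs q)

/-- The verifier's value of the sumcheck summand at the final point `r`:
`(∑_φ λ_φ P_φ(r, corrected reads)) · ∏ₜ EQ_H(rₜ, ρₜ)`. [cite: BabaiFortnowLund1991, §5] -/
def finalVal (π : Proof F K m C.N) (τ : Tape F C prm.T) : F :=
  (∑ φ, τ.lam φ * (C.fam φ).value τ.r fun j => scVal prm C π τ ⟨φ, j⟩) * ∏ t, eqPoly H (τ.r t) (τ.ρ t)

/-- The sumcheck messages read off the proof along the actual challenges. [cite: BabaiFortnowLund1991, §5] -/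
def msgs (π : Proof F K m C.N) (τ : Tape F C prm.T) : ℕ → F[X] := fun i => π.S τ.ρ τ.seed ((List.ofFn τ.r).take i)

/-- All low-degree tests pass. [cite: RubinfeldSudan1996, §4] -/
structure passRS (π : Proof F K m C.N) (τ : Tape F C prm.T) : Prop where
  /-- every test sum vanishes -/
  test : ∀ i, testSum (diffCoeff prm.d) prm.d π.Y (τ.tests i).1 (τ.tests i).2 = 0

omit [DecidableEq F] in
/-- Unfolding `passRS`. [folklore] -/
theorem passRS_iff (π : Proof F K m C.N) (τ : Tape F C prm.T) :
    passRS prm C π τ ↔ ∀ i, testSum (diffCoeff prm.d) prm.d π.Y (τ.tests i).1 (τ.tests i).2 = 0 :=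
  ⟨fun h => h.test, fun h => ⟨h⟩⟩

/-- The sumcheck checks pass, for the claimed value `0` and the verifier's own final value.
[cite: AroraBarakCC2009, §8.3.2] -/
structure passSum (π : Proof F K m C.N) (τ : Tape F C prm.T) : Prop where
  /-- the round checks -/
  round : ∀ i, i < K → (msgs prm C π τ i).natDegree ≤ prm.D ∧
      ∑ a ∈ H, (msgs prm C π τ i).eval a = chain 0 (msgs prm C π τ) (List.ofFn τ.r) i
  /-- the final check -/
  final : finalVal H prm C π τ = chain 0 (msgs prm C π τ) (List.ofFn τ.r) K

/-- **The verifier accepts.** [cite: BabaiFortnowLund1991, §5] -/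
structure Accept (π : Proof F K m C.N) (τ : Tape F C prm.T) : Prop where
  /-- the low-degree tests pass -/
  rs : passRS prm C π τ
  /-- the sumcheck passes -/
  sum : passSum H prm C π τ

/-! ### The summand of the analysis -/

/-- The random combination of the constraint values of an oracle `g`:
`Ψ_λ(z) = ∑_φ λ_φ P_φ(z, g ∘ addr)`. [cite: AroraBarakCC2009, §11.5.2] -/
def Ψ (g : (Fin m → F) → F) (lam : Fin C.N → F) (z : Fin K → F) : F := ∑ φ, lam φ * (C.fam φ).eval g z

/-- The sumcheck summand as a function on `Fᴷ`: `Ψ_λ(z) · ∏ₜ EQ_H(zₜ, ρₜ)`. [cite: BFLS1991, §5] -/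
def Gsum (g : (Fin m → F) → F) (ρ : Fin K → F) (lam : Fin C.N → F) (z : Fin K → F) : F :=
  Ψ C g lam z * ∏ t, eqPoly H (z t) (ρ t)

/-- The sumcheck summand in the list form of `SumcheckField.lean`. [cite: BFLS1991, §5] -/
def Φ (g : (Fin m → F) → F) (ρ : Fin K → F) (lam : Fin C.N → F) : List F → F :=
  fun l => Gsum H C g ρ lam fun t => l.getD t 0

variable {H prm C}

/-- **Degree of the summand**: for an oracle that is a polynomial of degree `≤ d` on every line,
`Ψ_λ` is coordinatewise of degree `≤ maxDeg · d`. [cite: AroraBarakCC2009, §8.6.2] -/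
theorem coordPoly_Ψ {g : (Fin m → F) → F} {d : ℕ} (hg : LinePoly g d) (hd : 1 ≤ d) (lam : Fin C.N → F) :
    CoordPoly (Ψ C g lam) (C.maxDeg * d) := by
  unfold Ψ
  refine CoordPoly.finset_sum _ fun φ _ => ?_
  have hcomp : CoordPoly (fun z => (C.fam φ).eval g z) ((C.fam φ).poly.totalDegree * d) := by
    unfold Family.eval Family.value
    have h := coordPoly_eval_mvPolynomial (k := K) (C.fam φ).poly
      (Gv := fun v z => Sum.elim z (fun j => g (readAddr ((C.fam φ).addr j) z)) v) (d := d) fun v => ?_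
    · refine (show (fun z => MvPolynomial.eval (Sum.elim z fun j => g (readAddr ((C.fam φ).addr j) z)) (C.fam φ).poly) =
          fun z => MvPolynomial.eval (fun v => Sum.elim z (fun j => g (readAddr ((C.fam φ).addr j) z)) v) (C.fam φ).poly
          from rfl) ▸ h
    · rcases v with i | j
      · simpa using (CoordPoly.proj 1 (P := Polynomial.X) natDegree_X_le i).mono hd
      · simpa using coordPoly_read hg ((C.fam φ).addr j)
  have h := (CoordPoly.const (k := K) 0 (lam φ)).mul hcomp
  simp only [zero_add] at h
  exact h.mono (Nat.mul_le_mul_right _ (C.totalDegree_le_maxDeg φ))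

/-- The summand on `Fᴷ` is coordinatewise of degree `≤ maxDeg · d + (#H - 1)`. [cite: BFLS1991, §5] -/
theorem coordPoly_Gsum {g : (Fin m → F) → F} {d : ℕ} (hg : LinePoly g d) (hd : 1 ≤ d) (ρ : Fin K → F)
    (lam : Fin C.N → F) : CoordPoly (Gsum H C g ρ lam) (C.maxDeg * d + (H.card - 1)) :=
  (coordPoly_Ψ hg hd lam).mul (coordPoly_prod_eqPoly H ρ)

/-- **The summand is admissible for the sumcheck protocol** (`SumcheckF.AxisPoly`).
[cite: AroraBarakCC2009, §8.3.2] -/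
theorem axisPoly_Φ {g : (Fin m → F) → F} {d : ℕ} (hg : LinePoly g d) (hd : 1 ≤ d) (ρ : Fin K → F)
    (lam : Fin C.N → F) : AxisPoly (Φ H C g ρ lam) K (C.maxDeg * d + (H.card - 1)) :=
  axisPoly_read (coordPoly_Gsum hg hd ρ lam) Fin.val_injective K

/-- **The sum checked by the protocol is the subcube zero test**: the full partial sum of the
summand is the low-degree extension of `Ψ_λ|_{Hᴷ}` at `ρ`. [cite: BFLS1991, §5] -/
theorem psum_Φ (g : (Fin m → F) → F) (ρ : Fin K → F) (lam : Fin C.N → F) :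
    psum H (Φ H C g ρ lam) K [] = lde H (Ψ C g lam) ρ := by
  unfold psum
  rw [List.length_nil, Nat.sub_zero, cubeSum_eq_sum, lde_eq_sum_eqPoly]
  refine sum_congr rfl fun c _ => ?_
  simp only [List.nil_append, Φ, Gsum, getD_ofFn]

/-- The self-corrected reads are correct for `g`. [folklore] -/
structure GoodSC (π : Proof F K m C.N) (τ : Tape F C prm.T) (g : (Fin m → F) → F) : Prop where
  /-- every self-corrected read is the value of `g` at the address -/
  eq : ∀ q : C.Qry, scVal prm C π τ q = g (readAddr ((C.fam q.1).addr q.2) τ.r)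

omit [DecidableEq F] in
/-- Unfolding `GoodSC`. [folklore] -/
theorem goodSC_iff (π : Proof F K m C.N) (τ : Tape F C prm.T) (g : (Fin m → F) → F) :
    GoodSC (prm := prm) π τ g ↔ ∀ q : C.Qry, scVal prm C π τ q = g (readAddr ((C.fam q.1).addr q.2) τ.r) :=
  ⟨fun h => h.eq, fun h => ⟨h⟩⟩

/-- **With correct reads, the verifier's final value is the summand at the challenge point.**
[cite: BabaiFortnowLund1991, §5] -/
theorem finalVal_eq_Φ {π : Proof F K m C.N} {τ : Tape F C prm.T} {g : (Fin m → F) → F}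
    (hsc : GoodSC π τ g) : finalVal H prm C π τ = Φ H C g τ.ρ τ.lam (List.ofFn τ.r) := by
  unfold finalVal Φ Gsum Ψ
  simp only [getD_ofFn]
  congr 1
  refine sum_congr rfl fun φ _ => ?_
  unfold Family.eval
  congr 2
  funext j
  exact hsc.eq ⟨φ, j⟩

/-- **Acceptance with correct reads is acceptance of the sumcheck protocol for the summand of the
analysis** (claimed value `0`). [cite: AroraBarakCC2009, Thm. 8.21] -/
theorem accepts_of_goodSC {π : Proof F K m C.N} {τ : Tape F C prm.T} {g : (Fin m → F) → F}
    (hacc : Accept H prm C π τ) (hsc : GoodSC π τ g) :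
    Accepts H (Φ H C g τ.ρ τ.lam) K prm.D 0 (msgs prm C π τ) (List.ofFn τ.r) :=
  ⟨fun i hi => (hacc.sum.round i hi).1, fun i hi => (hacc.sum.round i hi).2, by rw [← finalVal_eq_Φ hsc]; exact hacc.sum.final⟩

/-! ### Completeness -/

omit [DecidableEq F] in
/-- A well-formed family has the same value on two oracles agreeing on `Hᵐ`, at every index of `Hᴷ`. [folklore] -/
theorem eval_eq_of_agree_on_H {φ : Family F K m} (hφ : φ.WF H) {Y Y' : (Fin m → F) → F}
    (h : ∀ w : Fin m → F, (∀ u, w u ∈ H) → Y w = Y' w) {z : Fin K → F} (hz : ∀ t, z t ∈ H) :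
    φ.eval Y z = φ.eval Y' z :=
  φ.eval_congr fun j => h _ fun u => Family.readAddr_mem hφ j hz u

/-- **Completeness of the proof system.** If the CSP is well formed and satisfied by some table,
then — provided `d ≥ m (#H - 1)`, `D ≥ maxDeg · d + (#H - 1)`, `d ≥ 1` and `1, …, d` are nonzero
in `F` — the proof consisting of the low-degree extension `Ŷ` of the table and the honest sumcheck
messages for the summands `Φ(Ŷ, ρ, λ)` is accepted on EVERY tape: the extension passes all
low-degree tests (`fwdDiff_iter_lde_eq_zero`), the self-corrector is exact on it
(`selfCorrect_eq_of_linePoly`), the combination `Ψ_λ` vanishes on `Hᴷ` because `Ŷ` agrees with the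
table at all addresses of `H`-indices, so the claim `Ψ̂_λ(ρ) = 0` is true, and the honest messages
pass (`SumcheckF.completeness`). [cite: BabaiFortnowLund1991, §5 (completeness)] [cite: AroraBarakCC2009, §8.6] -/
theorem completeness (hWF : C.WF H) {Y₀ : (Fin m → F) → F} (hsat : C.Satisfies H Y₀)
    (hd : m * (H.card - 1) ≤ prm.d) (hd1 : 1 ≤ prm.d) (hD : C.maxDeg * prm.d + (H.card - 1) ≤ prm.D)
    (hunit : ∀ i : ℕ, 1 ≤ i → i ≤ prm.d → (i : F) ≠ 0) :
    ∃ π : Proof F K m C.N, ∀ τ : Tape F C prm.T, Accept H prm C π τ := by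
  classical
  -- the honest oracle and its regularity
  set Yh : (Fin m → F) → F := lde H Y₀ with hYh
  have hline : LinePoly Yh prm.d := by
    have h := linePoly_eval_mvPolynomial (ldePoly H Y₀)
    have hfun : (fun z => MvPolynomial.eval z (ldePoly H Y₀)) = Yh := funext (eval_ldePoly Y₀)
    rw [hfun] at h
    exact h.mono ((totalDegree_ldePoly_le Y₀).trans hd)
  have hΦ : ∀ (ρ : Fin K → F) (lam : Fin C.N → F), AxisPoly (Φ H C Yh ρ lam) K prm.D :=
    fun ρ lam => (axisPoly_Φ hline hd1 ρ lam).mono hD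
  -- `Ψ_λ(Ŷ)` vanishes on `Hᴷ`
  have hΨ : ∀ (lam : Fin C.N → F) (z : Fin K → F), (∀ t, z t ∈ H) → Ψ C Yh lam z = 0 := by
    intro lam z hz
    unfold Ψ
    refine sum_eq_zero fun φ _ => ?_
    rw [eval_eq_of_agree_on_H (hWF.wf φ) (fun w hw => lde_apply_of_mem Y₀ hw) hz, hsat.eval_eq_zero φ z hz, mul_zero]
  have hpsum : ∀ (ρ : Fin K → F) (lam : Fin C.N → F), psum H (Φ H C Yh ρ lam) K [] = 0 := by
    intro ρ lam
    rw [psum_Φ, lde_eq_sum_eqPoly]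
    exact sum_eq_zero fun c _ => by rw [hΨ lam _ fun t => (c t).2, zero_mul]
  -- the proof
  refine ⟨⟨Yh, fun ρ seed pref => roundPoly H (hΦ ρ fun φ => seed ^ (φ : ℕ)) pref⟩, fun τ => ⟨⟨fun i => ?_⟩, ?_⟩⟩
  · -- low-degree tests
    rw [testSum_diffCoeff]
    exact fwdDiff_iter_lde_eq_zero Y₀ hd _ _
  · -- sumcheck
    have hcomp := SumcheckF.completeness (H := H) (hΦ τ.ρ τ.lam) (r := List.ofFn τ.r) (List.length_ofFn)
    rw [hpsum] at hcomp
    have hsc : GoodSC (prm := prm) ⟨Yh, fun ρ seed pref => roundPoly H (hΦ ρ fun φ => seed ^ (φ : ℕ)) pref⟩ τ Yh :=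
      ⟨fun q => selfCorrect_eq_of_linePoly hunit hline _ _⟩
    refine ⟨fun i hi => ⟨hcomp.deg i hi, hcomp.sum i hi⟩, ?_⟩
    rw [finalVal_eq_Φ hsc]
    exact hcomp.final

end Verifier

end AlgebraicPCP

end Literature.Computability.Complexity

end
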